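import Summits.QuantumFields.BalabanUV.Beta.GAN24.BornLambdaContactPairCells

/-!
# `GAN24.BornLambdaContactPairCellBounds` — CT-ROUTE, the born-Λ RATE half («(C4)-DIFF», leaf-01 g61's `BORN-CONTACT-DIFF-PLAN-v0.md` §3, module D2b; generic `d`):
# **THE TWO CELL TYPES OF THE Λ CONTACT TERM, DIFFERENCED ACROSS TWO TOP-ALIGNED LINEAGES — ONE SLOT AT A TIME, PARAMETRIC IN EVERY LETTER**

NOT IN PRINT; OUR BOOKKEEPING (G-an2-4 formalisation swarm, leaf prover `b2b-balaban-gan24-formalise-leaf-01`, gen 61; INTENT «(C4)-DIFF» journal `CLAIMS.log` l.35799; socket holder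
leaf-06 g41's GO l.35804).  HONEST FRAMING (cell contract, verbatim): «discharging `BetaPertH` makes Bałaban's UV stability UNCONDITIONAL — a real constructive-QFT result; it is
NOT the continuum limit and NOT the Clay problem.»  HONEST DEPENDENCY (verbatim): «continuum YM on T⁴ ⇐ BetaPertH ∧ nine spine estimates (0/9 proved); BetaPertH ⇐ (D1) ∧ (D4) ∧ CAP+tail;
G-an2-4 gates asym, D1 and NE2/3/4.»

WHAT (generic `d`, `1 ≤ Lc`, box root `ρ = toSite rr`, ONE rate `κ > 0`; the cells of leaf-02 g49's (C4) PART 3: the MIXED cell `Σ_μ Σ'_y b μ y·[𝒬^ρ_{Lc}, ψ̄]R (μ,y)` and the ΔΔ cell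
`Σ_μ Σ'_y b μ y·[𝒬^ρ_{Lc}, ψ̄_a](dz ψ_b)(μ,y)`).  Two lineages (primed = the next member's, born one level up; unprimed) on the SAME lattice (plan §1) differ in every slot by a
LETTERED amount: brackets `|b′ − b| ≤ T_Δ·E`, staircases `ψ′ − ψ = Σ_s G_Δ s ∘ blk (Lc^s)` with pieces `≤ α_Δ·Lc^s·E`, legs `|R′ − R| ≤ K_Δ·E`.  Then, slot by slot (D2a's
`sum_tsum_cell_sub_cell` + `commutator_sub_commutator`) and cell by cell (leaf-02's `abs_sum_tsum_mixed_le`, D2a's two-amplitude `abs_sum_tsum_dz_le₂`):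
* §1 **`abs_mixedPair_le`**: `|Σ_μΣ'_y b′·[𝒬,ψ̄′]R′ − Σ_μΣ'_y b·[𝒬,ψ̄]R| ≤ (d+1)·(E₀²·Cnt)·(T_Δ·K′·(4α′ + 2α′·Lc·n) + T·K′·(4α_Δ + 2α_Δ·Lc·n) + T·K_Δ·(4α + 2α·Lc·n))·((Lc^n)^{d+1}·Zl)·e^{−(κ∕12)(…)}`;
* §2 **`abs_dzPair_le`**: `|Σ_μΣ'_y b′·[𝒬,ψ̄′_a](dzψ′_b) − Σ_μΣ'_y b·[𝒬,ψ̄_a](dzψ_b)| ≤ (d+1)·(E₀²·Cnt)·(T_Δ·(8α′²+12α′²·Lc·n) + T·(8α_Δα′+12α_Δα′·Lc·n) + T·(8αα_Δ+12αα_Δ·Lc·n))·((Lc^n)^{d+1}·Zl)·e^{−(κ∕12)(…)}`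
(both sources `x_g`, `x_l` as in (C4) PART 3; `E₀ = e^{2(d+1)κ}`, `Cnt` the count constant).  Every term carries EXACTLY ONE Δ-letter — the contact PAIR is θ-small as soon as
`T_Δ, α_Δ, K_Δ` are (D3: θ_K^{k−1}, θ^{k−1}, θ^{k−1} at `d = 3`).
[folklore] throughout: leaf-02 g49's cell lemmas + D2a BY NAME; 0 `def`, 0 cited facts, 0 `def … : Prop`, 0 sorry.  NO estimate of Bałaban's; discharges NOTHING of hBdev(0,cΛ) ∕
hSdev by itself (D2c assembles the pair ENTRY bound through leaf-02 g48's socket; D3 the `d = 3` letters; END = leaf-06 g41's `hPc`); 0 wall binders; NEVER «G-an2-4 closed»; NOT D1,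
NOT BetaPertH, NOT continuum, NOT Clay.
-/

noncomputable section

open Finset
open scoped BigOperators
open Literature.MathematicalPhysics.QuantumFieldTheory
open Literature.MathematicalPhysics.QuantumFieldTheory.LatticeForm (quo)
open Literature.MathematicalPhysics.QuantumFieldTheory.Balaban1983to89
open Literature.MathematicalPhysics.QuantumFieldTheory.Balaban1983to89.Beta
open B4ContourShift (supNorm supNorm_nonneg)
open ExpKernelCalculus (Zl Zl_nonneg)
open AffineAveraging (Form0 Form1 Site box toSite unitVec dz)
open AveragingContours (blk)
open AveragingContoursRooted (linAvgAt)
open AveragingHessianKernels (ell)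
open Summit.QuantumFields.BalabanUV.Beta.GAN24.ContactLambdaEntryBound (abs_sum_tsum_mixed_le abs_sum_tsum_dz_le)
open Summit.QuantumFields.BalabanUV.Beta.GAN24.BornLambdaContactPairCells (commutator_sub_commutator sum_tsum_cell_sub_cell abs_sum_tsum_dz_le₂)

namespace Summit.QuantumFields.BalabanUV.Beta.GAN24.BornLambdaContactPairCellBounds

variable {d : ℕ} {Lc : ℕ} {rr : Fin (d + 1) → ℕ} {n : ℕ} {κ : ℝ} {xg xl u' : Site (d + 1)}

/-! ## §1 The mixed cell pair -/

section Mixed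

variable {α' α αΔ K' K KΔ T' T TΔ : ℝ} {G' G GΔ : ℕ → Site (d + 1) → ℝ} {ψ' ψ : Site (d + 1) → ℝ} {R' R : Form1 (d + 1) ℝ}
  {b' b : Fin (d + 1) → Site (d + 1) → ℝ}

/-- NOT IN PRINT; OUR BOOKKEEPING.  **THE MIXED CELL, DIFFERENCED ACROSS THE TWO LINEAGES** (generic `d`; every slot lettered, every term ONE Δ-letter):
`|Σ_μ Σ'_y b′ μ y·[𝒬^ρ_{Lc}, ψ̄′]R′(μ,y) − Σ_μ Σ'_y b μ y·[𝒬^ρ_{Lc}, ψ̄]R(μ,y)|`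
`≤ (d+1)·(E₀²·Cnt)·(T_Δ·K′·(4α′ + 2α′·Lc·n) + T·K′·(4α_Δ + 2α_Δ·Lc·n) + T·K_Δ·(4α + 2α·Lc·n))·((Lc^n)^{d+1}·Zl(κ∕(4(d+1))))·e^{−(κ∕12)(‖x_g − u′‖∞ + ‖x_l − u′‖∞)}`. -/
theorem abs_mixedPair_le (hLc : 1 ≤ Lc) (hrr : rr ∈ box (d + 1) Lc) (hκ : 0 < κ)
    (hα' : 0 ≤ α') (hα : 0 ≤ α) (hαΔ : 0 ≤ αΔ) (hK' : 0 ≤ K') (hK : 0 ≤ K) (hKΔ : 0 ≤ KΔ) (hT' : 0 ≤ T') (hT : 0 ≤ T) (hTΔ : 0 ≤ TΔ)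
    (hψ' : ∀ u, ψ' u = ∑ s ∈ Finset.range (n + 1), G' s (blk (Lc ^ s) u))
    (hψ : ∀ u, ψ u = ∑ s ∈ Finset.range (n + 1), G s (blk (Lc ^ s) u))
    (hψΔ : ∀ u, ψ' u - ψ u = ∑ s ∈ Finset.range (n + 1), GΔ s (blk (Lc ^ s) u))
    (hG' : ∀ s, s ≤ n → ∀ u, |G' s (blk (Lc ^ s) u)| ≤ α' * (Lc : ℝ) ^ s * Real.exp (-(κ * supNorm (quo (Lc ^ (n + 1)) u - xg))))
    (hG : ∀ s, s ≤ n → ∀ u, |G s (blk (Lc ^ s) u)| ≤ α * (Lc : ℝ) ^ s * Real.exp (-(κ * supNorm (quo (Lc ^ (n + 1)) u - xg))))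
    (hGΔ : ∀ s, s ≤ n → ∀ u, |GΔ s (blk (Lc ^ s) u)| ≤ αΔ * (Lc : ℝ) ^ s * Real.exp (-(κ * supNorm (quo (Lc ^ (n + 1)) u - xg))))
    (hR' : ∀ a x, |R' a x| ≤ K' * Real.exp (-(κ * supNorm (quo (Lc ^ (n + 1)) x - xl))))
    (hR : ∀ a x, |R a x| ≤ K * Real.exp (-(κ * supNorm (quo (Lc ^ (n + 1)) x - xl))))
    (hRΔ : ∀ a x, |R' a x - R a x| ≤ KΔ * Real.exp (-(κ * supNorm (quo (Lc ^ (n + 1)) x - xl))))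
    (hb' : ∀ μ y, |b' μ y| ≤ T' * Real.exp (-(κ * supNorm (quo (Lc ^ n) y - u'))))
    (hb : ∀ μ y, |b μ y| ≤ T * Real.exp (-(κ * supNorm (quo (Lc ^ n) y - u'))))
    (hbΔ : ∀ μ y, |b' μ y - b μ y| ≤ TΔ * Real.exp (-(κ * supNorm (quo (Lc ^ n) y - u')))) :
    |(∑ μ, ∑' y : Site (d + 1), b' μ y *
        (linAvgAt (toSite rr) (fun a x => (ψ' x + ψ' (x + unitVec a)) * R' a x) Lc μ y
          - (ψ' ((Lc : ℤ) • y + toSite rr) + ψ' ((Lc : ℤ) • y + toSite rr + (Lc : ℤ) • unitVec μ)) * linAvgAt (toSite rr) R' Lc μ y))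
      - ∑ μ, ∑' y : Site (d + 1), b μ y *
        (linAvgAt (toSite rr) (fun a x => (ψ x + ψ (x + unitVec a)) * R a x) Lc μ y
          - (ψ ((Lc : ℤ) • y + toSite rr) + ψ ((Lc : ℤ) • y + toSite rr + (Lc : ℤ) • unitVec μ)) * linAvgAt (toSite rr) R Lc μ y)|
      ≤ ((d : ℝ) + 1) * (Real.exp (2 * ((d : ℝ) + 1) * κ) ^ 2 *
            (((2 * Lc : ℕ) : ℝ) ^ (d + 1) * (((d + 1 : ℕ) : ℝ) * ((Lc : ℝ) ^ (d + 1) * (ell (d + 1) Lc : ℝ)))))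
          * (TΔ * K' * (4 * α' + 2 * α' * Lc * n) + T * K' * (4 * αΔ + 2 * αΔ * Lc * n) + T * KΔ * (4 * α + 2 * α * Lc * n))
          * ((((Lc ^ n : ℕ) : ℝ)) ^ (d + 1) * Zl (d + 1) (κ / (4 * ((d : ℝ) + 1))))
          * Real.exp (-(κ / 12) * (supNorm (xg - u') + supNorm (xl - u'))) := by
  -- the three differenced cells and the two undifferenced ones (summability + bounds), all by leaf-02's mixed-cell lemma
  obtain ⟨hs1, hb1⟩ := abs_sum_tsum_mixed_le (b := fun μ y => b' μ y - b μ y) hLc hrr hκ hα' hK' hTΔ hψ' hG' hR' hbΔ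
  obtain ⟨hs2, hb2⟩ := abs_sum_tsum_mixed_le (ψ := fun u => ψ' u - ψ u) (b := b) hLc hrr hκ hαΔ hK' hT hψΔ hGΔ hR' hb
  obtain ⟨hs3, hb3⟩ := abs_sum_tsum_mixed_le (R := fun a x => R' a x - R a x) (b := b) hLc hrr hκ hα hKΔ hT hψ hG hRΔ hb
  obtain ⟨hs', -⟩ := abs_sum_tsum_mixed_le (b := b') hLc hrr hκ hα' hK' hT' hψ' hG' hR' hb'
  obtain ⟨hs, -⟩ := abs_sum_tsum_mixed_le (b := b) hLc hrr hκ hα hK hT hψ hG hR hb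
  -- the second factor splits by D2a's commutator identity; its (b ·)-products are summable term by term
  have hsplit : ∀ μ, Summable fun y : Site (d + 1) => b μ y *
      ((linAvgAt (toSite rr) (fun a x => (ψ' x + ψ' (x + unitVec a)) * R' a x) Lc μ y
          - (ψ' ((Lc : ℤ) • y + toSite rr) + ψ' ((Lc : ℤ) • y + toSite rr + (Lc : ℤ) • unitVec μ)) * linAvgAt (toSite rr) R' Lc μ y)
        - (linAvgAt (toSite rr) (fun a x => (ψ x + ψ (x + unitVec a)) * R a x) Lc μ y
          - (ψ ((Lc : ℤ) • y + toSite rr) + ψ ((Lc : ℤ) • y + toSite rr + (Lc : ℤ) • unitVec μ)) * linAvgAt (toSite rr) R Lc μ y)) := by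
    intro μ
    refine ((hs2 μ).add (hs3 μ)).congr fun y => ?_
    rw [commutator_sub_commutator (toSite rr) Lc ψ' ψ R' R μ y]
    ring
  rw [sum_tsum_cell_sub_cell hs1 hsplit hs' hs]
  -- the second sum splits further
  have hsplit2 : (∑ μ, ∑' y : Site (d + 1), b μ y *
      ((linAvgAt (toSite rr) (fun a x => (ψ' x + ψ' (x + unitVec a)) * R' a x) Lc μ y
          - (ψ' ((Lc : ℤ) • y + toSite rr) + ψ' ((Lc : ℤ) • y + toSite rr + (Lc : ℤ) • unitVec μ)) * linAvgAt (toSite rr) R' Lc μ y)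
        - (linAvgAt (toSite rr) (fun a x => (ψ x + ψ (x + unitVec a)) * R a x) Lc μ y
          - (ψ ((Lc : ℤ) • y + toSite rr) + ψ ((Lc : ℤ) • y + toSite rr + (Lc : ℤ) • unitVec μ)) * linAvgAt (toSite rr) R Lc μ y)))
      = (∑ μ, ∑' y : Site (d + 1), b μ y *
          (linAvgAt (toSite rr) (fun a x => ((fun x => ψ' x - ψ x) x + (fun x => ψ' x - ψ x) (x + unitVec a)) * R' a x) Lc μ y
            - ((fun x => ψ' x - ψ x) ((Lc : ℤ) • y + toSite rr) + (fun x => ψ' x - ψ x) ((Lc : ℤ) • y + toSite rr + (Lc : ℤ) • unitVec μ))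
              * linAvgAt (toSite rr) R' Lc μ y))
        + ∑ μ, ∑' y : Site (d + 1), b μ y *
          (linAvgAt (toSite rr) (fun a x => (ψ x + ψ (x + unitVec a)) * (fun a x => R' a x - R a x) a x) Lc μ y
            - (ψ ((Lc : ℤ) • y + toSite rr) + ψ ((Lc : ℤ) • y + toSite rr + (Lc : ℤ) • unitVec μ))
              * linAvgAt (toSite rr) (fun a x => R' a x - R a x) Lc μ y) := by
    rw [← Finset.sum_add_distrib]
    refine Finset.sum_congr rfl fun μ _ => ?_
    rw [← (hs2 μ).tsum_add (hs3 μ)]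
    refine tsum_congr fun y => ?_
    rw [commutator_sub_commutator (toSite rr) Lc ψ' ψ R' R μ y]
    ring
  rw [hsplit2]
  refine ((abs_add_le _ _).trans (add_le_add hb1 ((abs_add_le _ _).trans (add_le_add hb2 hb3)))).trans (le_of_eq ?_)
  ring

end Mixed

/-! ## §2 The ΔΔ cell pair -/

section DeltaDelta

variable {αa' αa αaΔ αb' αb αbΔ T' T TΔ : ℝ} {Ga' Ga GaΔ Gb' Gb GbΔ : ℕ → Site (d + 1) → ℝ} {ψa' ψa ψb' ψb : Site (d + 1) → ℝ}
  {b' b : Fin (d + 1) → Site (d + 1) → ℝ}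

/-- [folklore] `dz` of a difference, pointwise. -/
theorem dz_sub_apply (f g : Site (d + 1) → ℝ) (a : Fin (d + 1)) (x : Site (d + 1)) :
    dz f a x - dz g a x = dz (fun u => f u - g u) a x := by
  simp only [dz]
  ring

/-- NOT IN PRINT; OUR BOOKKEEPING.  **THE ΔΔ CELL, DIFFERENCED ACROSS THE TWO LINEAGES** (generic `d`; every slot lettered, every term ONE Δ-letter):
`|Σ_μ Σ'_y b′ μ y·[𝒬^ρ_{Lc}, ψ̄′_a](dz ψ′_b)(μ,y) − Σ_μ Σ'_y b μ y·[𝒬^ρ_{Lc}, ψ̄_a](dz ψ_b)(μ,y)|`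
`≤ (d+1)·(E₀²·Cnt)·(T_Δ·(8α′_aα′_b + 12α′_aα′_b·Lc·n) + T·(8α_{aΔ}α′_b + 12α_{aΔ}α′_b·Lc·n) + T·(8α_aα_{bΔ} + 12α_aα_{bΔ}·Lc·n))·((Lc^n)^{d+1}·Zl)·e^{−(κ∕12)(…)}`. -/
theorem abs_dzPair_le (hLc : 1 ≤ Lc) (hrr : rr ∈ box (d + 1) Lc) (hκ : 0 < κ)
    (hαa' : 0 ≤ αa') (hαa : 0 ≤ αa) (hαaΔ : 0 ≤ αaΔ) (hαb' : 0 ≤ αb') (hαb : 0 ≤ αb) (hαbΔ : 0 ≤ αbΔ) (hT' : 0 ≤ T') (hT : 0 ≤ T) (hTΔ : 0 ≤ TΔ)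
    (hψa' : ∀ u, ψa' u = ∑ s ∈ Finset.range (n + 1), Ga' s (blk (Lc ^ s) u))
    (hψa : ∀ u, ψa u = ∑ s ∈ Finset.range (n + 1), Ga s (blk (Lc ^ s) u))
    (hψaΔ : ∀ u, ψa' u - ψa u = ∑ s ∈ Finset.range (n + 1), GaΔ s (blk (Lc ^ s) u))
    (hψb' : ∀ u, ψb' u = ∑ s ∈ Finset.range (n + 1), Gb' s (blk (Lc ^ s) u))
    (hψb : ∀ u, ψb u = ∑ s ∈ Finset.range (n + 1), Gb s (blk (Lc ^ s) u))
    (hψbΔ : ∀ u, ψb' u - ψb u = ∑ s ∈ Finset.range (n + 1), GbΔ s (blk (Lc ^ s) u))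
    (hGa' : ∀ s, s ≤ n → ∀ u, |Ga' s (blk (Lc ^ s) u)| ≤ αa' * (Lc : ℝ) ^ s * Real.exp (-(κ * supNorm (quo (Lc ^ (n + 1)) u - xg))))
    (hGa : ∀ s, s ≤ n → ∀ u, |Ga s (blk (Lc ^ s) u)| ≤ αa * (Lc : ℝ) ^ s * Real.exp (-(κ * supNorm (quo (Lc ^ (n + 1)) u - xg))))
    (hGaΔ : ∀ s, s ≤ n → ∀ u, |GaΔ s (blk (Lc ^ s) u)| ≤ αaΔ * (Lc : ℝ) ^ s * Real.exp (-(κ * supNorm (quo (Lc ^ (n + 1)) u - xg))))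
    (hGb' : ∀ s, s ≤ n → ∀ u, |Gb' s (blk (Lc ^ s) u)| ≤ αb' * (Lc : ℝ) ^ s * Real.exp (-(κ * supNorm (quo (Lc ^ (n + 1)) u - xl))))
    (hGb : ∀ s, s ≤ n → ∀ u, |Gb s (blk (Lc ^ s) u)| ≤ αb * (Lc : ℝ) ^ s * Real.exp (-(κ * supNorm (quo (Lc ^ (n + 1)) u - xl))))
    (hGbΔ : ∀ s, s ≤ n → ∀ u, |GbΔ s (blk (Lc ^ s) u)| ≤ αbΔ * (Lc : ℝ) ^ s * Real.exp (-(κ * supNorm (quo (Lc ^ (n + 1)) u - xl))))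
    (hb' : ∀ μ y, |b' μ y| ≤ T' * Real.exp (-(κ * supNorm (quo (Lc ^ n) y - u'))))
    (hb : ∀ μ y, |b μ y| ≤ T * Real.exp (-(κ * supNorm (quo (Lc ^ n) y - u'))))
    (hbΔ : ∀ μ y, |b' μ y - b μ y| ≤ TΔ * Real.exp (-(κ * supNorm (quo (Lc ^ n) y - u')))) :
    |(∑ μ, ∑' y : Site (d + 1), b' μ y *
        (linAvgAt (toSite rr) (fun a x => (ψa' x + ψa' (x + unitVec a)) * dz ψb' a x) Lc μ y
          - (ψa' ((Lc : ℤ) • y + toSite rr) + ψa' ((Lc : ℤ) • y + toSite rr + (Lc : ℤ) • unitVec μ)) * linAvgAt (toSite rr) (dz ψb') Lc μ y))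
      - ∑ μ, ∑' y : Site (d + 1), b μ y *
        (linAvgAt (toSite rr) (fun a x => (ψa x + ψa (x + unitVec a)) * dz ψb a x) Lc μ y
          - (ψa ((Lc : ℤ) • y + toSite rr) + ψa ((Lc : ℤ) • y + toSite rr + (Lc : ℤ) • unitVec μ)) * linAvgAt (toSite rr) (dz ψb) Lc μ y)|
      ≤ ((d : ℝ) + 1) * (Real.exp (2 * ((d : ℝ) + 1) * κ) ^ 2 *
            (((2 * Lc : ℕ) : ℝ) ^ (d + 1) * (((d + 1 : ℕ) : ℝ) * ((Lc : ℝ) ^ (d + 1) * (ell (d + 1) Lc : ℝ)))))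
          * (TΔ * (8 * (αa' * αb') + 2 * (6 * (αa' * αb')) * Lc * n) + T * (8 * (αaΔ * αb') + 2 * (6 * (αaΔ * αb')) * Lc * n)
              + T * (8 * (αa * αbΔ) + 2 * (6 * (αa * αbΔ)) * Lc * n))
          * ((((Lc ^ n : ℕ) : ℝ)) ^ (d + 1) * Zl (d + 1) (κ / (4 * ((d : ℝ) + 1))))
          * Real.exp (-(κ / 12) * (supNorm (xg - u') + supNorm (xl - u'))) := by
  obtain ⟨hs1, hb1⟩ := abs_sum_tsum_dz_le₂ (b := fun μ y => b' μ y - b μ y) hLc hrr hκ hαa' hαb' hTΔ hψa' hψb' hGa' hGb' hbΔ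
  obtain ⟨hs2, hb2⟩ := abs_sum_tsum_dz_le₂ (ψa := fun u => ψa' u - ψa u) (b := b) hLc hrr hκ hαaΔ hαb' hT hψaΔ hψb' hGaΔ hGb' hb
  obtain ⟨hs3, hb3⟩ := abs_sum_tsum_dz_le₂ (ψb := fun u => ψb' u - ψb u) (b := b) hLc hrr hκ hαa hαbΔ hT hψa hψbΔ hGa hGbΔ hb
  obtain ⟨hs', -⟩ := abs_sum_tsum_dz_le₂ (b := b') hLc hrr hκ hαa' hαb' hT' hψa' hψb' hGa' hGb' hb'
  obtain ⟨hs, -⟩ := abs_sum_tsum_dz_le₂ (b := b) hLc hrr hκ hαa hαb hT hψa hψb hGa hGb hb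
  -- the dz of the differenced staircase is the difference of the dz's
  have edz : (dz fun u => ψb' u - ψb u) = fun a x => dz ψb' a x - dz ψb a x := by
    funext a x
    exact (dz_sub_apply ψb' ψb a x).symm
  rw [edz] at hs3 hb3
  have hsplit : ∀ μ, Summable fun y : Site (d + 1) => b μ y *
      ((linAvgAt (toSite rr) (fun a x => (ψa' x + ψa' (x + unitVec a)) * dz ψb' a x) Lc μ y
          - (ψa' ((Lc : ℤ) • y + toSite rr) + ψa' ((Lc : ℤ) • y + toSite rr + (Lc : ℤ) • unitVec μ)) * linAvgAt (toSite rr) (dz ψb') Lc μ y)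
        - (linAvgAt (toSite rr) (fun a x => (ψa x + ψa (x + unitVec a)) * dz ψb a x) Lc μ y
          - (ψa ((Lc : ℤ) • y + toSite rr) + ψa ((Lc : ℤ) • y + toSite rr + (Lc : ℤ) • unitVec μ)) * linAvgAt (toSite rr) (dz ψb) Lc μ y)) := by
    intro μ
    refine ((hs2 μ).add (hs3 μ)).congr fun y => ?_
    rw [commutator_sub_commutator (toSite rr) Lc ψa' ψa (dz ψb') (dz ψb) μ y]
    ring
  rw [sum_tsum_cell_sub_cell hs1 hsplit hs' hs]
  have hsplit2 : (∑ μ, ∑' y : Site (d + 1), b μ y *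
      ((linAvgAt (toSite rr) (fun a x => (ψa' x + ψa' (x + unitVec a)) * dz ψb' a x) Lc μ y
          - (ψa' ((Lc : ℤ) • y + toSite rr) + ψa' ((Lc : ℤ) • y + toSite rr + (Lc : ℤ) • unitVec μ)) * linAvgAt (toSite rr) (dz ψb') Lc μ y)
        - (linAvgAt (toSite rr) (fun a x => (ψa x + ψa (x + unitVec a)) * dz ψb a x) Lc μ y
          - (ψa ((Lc : ℤ) • y + toSite rr) + ψa ((Lc : ℤ) • y + toSite rr + (Lc : ℤ) • unitVec μ)) * linAvgAt (toSite rr) (dz ψb) Lc μ y)))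
      = (∑ μ, ∑' y : Site (d + 1), b μ y *
          (linAvgAt (toSite rr) (fun a x => ((fun x => ψa' x - ψa x) x + (fun x => ψa' x - ψa x) (x + unitVec a)) * dz ψb' a x) Lc μ y
            - ((fun x => ψa' x - ψa x) ((Lc : ℤ) • y + toSite rr) + (fun x => ψa' x - ψa x) ((Lc : ℤ) • y + toSite rr + (Lc : ℤ) • unitVec μ))
              * linAvgAt (toSite rr) (dz ψb') Lc μ y))
        + ∑ μ, ∑' y : Site (d + 1), b μ y *
          (linAvgAt (toSite rr) (fun a x => (ψa x + ψa (x + unitVec a)) * (fun a x => dz ψb' a x - dz ψb a x) a x) Lc μ y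
            - (ψa ((Lc : ℤ) • y + toSite rr) + ψa ((Lc : ℤ) • y + toSite rr + (Lc : ℤ) • unitVec μ))
              * linAvgAt (toSite rr) (fun a x => dz ψb' a x - dz ψb a x) Lc μ y) := by
    rw [← Finset.sum_add_distrib]
    refine Finset.sum_congr rfl fun μ _ => ?_
    rw [← (hs2 μ).tsum_add (hs3 μ)]
    refine tsum_congr fun y => ?_
    rw [commutator_sub_commutator (toSite rr) Lc ψa' ψa (dz ψb') (dz ψb) μ y]
    ring
  rw [hsplit2]
  refine ((abs_add_le _ _).trans (add_le_add hb1 ((abs_add_le _ _).trans (add_le_add hb2 hb3)))).trans (le_of_eq ?_)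
  ring

end DeltaDelta

end Summit.QuantumFields.BalabanUV.Beta.GAN24.BornLambdaContactPairCellBounds

end
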